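import Mathlib
import Literature.AlgebraicGeometry.HyperbolicPolynomials.HyperbolicityCone
import HarnessLib

/-!
# Spectrahedral shadows (lifted LMI representations) of hyperbolicity cones

Topic `Literature/AlgebraicGeometry/HyperbolicPolynomials`. Vocabulary and two named facts for
route `ValiantsHypothesis/PermanentalCones`, whose items `PermanentalConesEasy`,
`HyperbolicDetShadow`, `PermanentalConeHard`, `HyperbolicVPShadow` inline the clause
"`{x | ∀ τ > 0, f(x + τ e) ≠ 0} = {x | ∃ y, A(x,y) + B ⪰ 0}` for some linear `A` into `m × m` real
matrices and a constant `B`" (a *lifted LMI* / *spectrahedral shadow* description of **size `m`**).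

## Contents (namespace `Literature.AlgebraicGeometry.HyperbolicPolynomials`)

* `IsSpectrahedralShadowOfSize K m` — `K ⊆ ℝ^σ` has a lifted-LMI description with `m × m` real
  matrices: `∃ p, A : ℝ^σ × ℝ^p →ₗ Mat_m(ℝ), B ∈ Mat_m(ℝ)` with `x ∈ K ↔ ∃ y, A(x,y) + B ⪰ 0`
  (Mathlib's `Matrix.PosSemidef`, which includes symmetry). This is literally the shape used in
  the route items, so they restate over it by `Iff.rfl` after unfolding `hyperbolicityCone`.
  Netzer–Sanyal 2015, §1: "The image of a spectrahedron under a linear projection is called a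
  *spectrahedral shadow*"; Scheiderer 2025 (arXiv:2509.17121), (1): "lifted LMI representation
  `C_e(f) = {x : ∃ y, Σ xᵢAᵢ + Σ yⱼBⱼ ⪰ 0}`"; Saunderson–Parrilo 2015, §1: "If we can write a cone
  as the projection of a slice of the cone of `m × m` positive semidefinite matrices, we say it has
  a semidefinite representation of size `m`" (the same notion up to the standard
  graph/parametrisation translation, which changes `m` by at most an additive constant — absorbed
  in the `O(·)` of `SaundersonParrilo2014_thm1_orthant`).
* `IsSpectrahedralShadow K := ∃ m, IsSpectrahedralShadowOfSize K m`.
* FACT `NetzerSanyal2014_thm11` — **smooth hyperbolicity cones are spectrahedral shadows**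
  (Netzer–Sanyal, Math. Program. 153 (2015) 213–221, Theorem 1.1, read at arXiv:1208.0441 p. 3:
  "Let `h ∈ ℝ[x]` be hyperbolic with respect to `e`. If each non-zero point in the boundary of
  `Λ_e(h)` is a smooth point of `h`, then `Λ_e(h)` is a spectrahedral shadow." — there `h` is
  homogeneous (§1), `Λ_e(h)` is the CLOSED cone `{a : h(a − te) has only non-negative roots}`
  = `hyperbolicityCone h e`, and "smooth point" = multiplicity one (§2), i.e. `∇h(a) ≠ 0` at the
  boundary points `a ≠ 0`, where `h(a) = 0` automatically).
* FACT `SaundersonParrilo2014_thm1_orthant` — **polynomial-sized semidefinite representations of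
  the derivative relaxations of the orthant** (Saunderson–Parrilo, Math. Program. 153 (2015)
  309–331, Theorem 1, read at arXiv:1208.1443 p. 6: "For each positive integer `n` and each
  `k = 1, 2, …, n−1`, the cone `S^{n,(k)}_+` has a semidefinite representation of size
  `O(min{k, n−k} n²)`", together with §1.2 (p. 4): "the `k`th derivative relaxation of the
  orthant … `ℝ^{n,(k)}_+` is the hyperbolicity cone `Λ_+(e_{n−k}, 𝟙_n)`" and "the diagonal slice
  of `S^{n,(k)}_+` is exactly `ℝ^{n,(k)}_+`" — a slice of a size-`m` representation is a size-`m`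
  representation). Vendored in the orthant form the route uses (single-direction Renegar
  derivatives `D_𝟙^k (x₁⋯xₙ) = k! e_{n−k}`), with the unprinted `O`-constant as `∃ C`.

## Status of the general statements (for the route's cruxes; not vendored, not facts)

"Every hyperbolicity cone is a spectrahedral shadow" is OPEN (Netzer–Sanyal p. 6: "we conjecture
that all hyperbolicity cones are spectrahedral shadows"; Scheiderer 2025 Thm 1.1 extends Thm 1.1
here to Nash-smooth boundary with `2 × 2` blocks, still without size control); "every
hyperbolicity cone is spectrahedral" (generalized Lax conjecture) is open for `n ≥ 4`
(Helton–Vinnikov `n = 3`). Size LOWER bounds in print are for sections only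
(Raghavendra–Ryder–Srivastava–Weitz 2019, Thm 2: generic binary perturbations of `e_d` need
dimension `≥ (n/d)^{κd}`); nothing super-logarithmic is printed for shadows of any explicit
non-polyhedral cone.

## Design / Mathlib

Mathlib has `Matrix.PosSemidef` but no spectrahedra / SDP-representability notion (searched
`spectrahedr`, `Spectrahedr`, `LMI`: 0 declarations in Mathlib + project). Facts are `def … : Prop`
(D-0014); users take `(h : NetzerSanyal2014_thm11)`.

## References

* [NetzerSanyal2014] T. Netzer, R. Sanyal, *Smooth hyperbolicity cones are spectrahedral shadows*,
  Math. Program. 153 (2015) 213–221 (arXiv:1208.0441): §1 (definitions), Thm 1.1 (p. 3), §2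
  (smooth point = multiplicity one), Thm 3.1 + proof of Thm 1.1 (p. 6).
* [SaundersonParrilo2014] J. Saunderson, P. A. Parrilo, *Polynomial-sized semidefinite
  representations of derivative relaxations of spectrahedral cones*, Math. Program. 153 (2015)
  309–331 (arXiv:1208.1443): §1 (size of a semidefinite representation), §1.2 (`ℝ^{n,(k)}_+ =
  Λ_+(e_{n−k}, 𝟙)`, diagonal slice), §2 Thm 1 (p. 6).
* [Renegar2006] J. Renegar, Found. Comput. Math. 6 (2006) §2 (closed cone `Λ_+`).
-/

noncomputable section

open MvPolynomial
open scoped BigOperators Matrix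

namespace Literature.AlgebraicGeometry.HyperbolicPolynomials

variable {σ : Type*}

/-! ### Lifted LMI representations of a given size -/

/-- **Spectrahedral shadow (lifted LMI representation) of size `m`**: `K ⊆ ℝ^σ` equals
`{x | ∃ y ∈ ℝ^p, A(x, y) + B ⪰ 0}` for some number `p` of lifting variables, a real-linear map
`A : ℝ^σ × ℝ^p → Mat_{m×m}(ℝ)` and a constant matrix `B` (Mathlib's `Matrix.PosSemidef` includes
`IsHermitian`, so non-symmetric data simply describe the empty set). Netzer–Sanyal 2015, §1
("image of a spectrahedron under a linear projection … spectrahedral shadow"); Scheiderer 2025,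
(1) ("lifted LMI representation"); Saunderson–Parrilo 2015, §1 ("semidefinite representation of
size `m`": projection of a slice of the `m × m` PSD cone — the same notion up to an additive
constant in `m`). Written in exactly the shape inlined by the `PermanentalCones` route items.
[cite: NetzerSanyal2014, §1 (spectrahedral shadow); SaundersonParrilo2014, §1 (size m)] -/
def IsSpectrahedralShadowOfSize (K : Set (σ → ℝ)) (m : ℕ) : Prop :=
  ∃ (p : ℕ) (A : (σ → ℝ) × (Fin p → ℝ) →ₗ[ℝ] Matrix (Fin m) (Fin m) ℝ) (B : Matrix (Fin m) (Fin m) ℝ),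
    ∀ x : σ → ℝ, x ∈ K ↔ ∃ y : Fin p → ℝ, (A (x, y) + B).PosSemidef

/-- **Spectrahedral shadow** (semidefinitely representable set): a lifted LMI representation of
some size exists. [cite: NetzerSanyal2014, §1 (spectrahedral shadow)] -/
def IsSpectrahedralShadow (K : Set (σ → ℝ)) : Prop :=
  ∃ m : ℕ, IsSpectrahedralShadowOfSize K m

/-- Unfolding lemma (the lifted-LMI clause as inlined by the route items).
[cite: NetzerSanyal2014, §1 (spectrahedral shadow)] -/
theorem isSpectrahedralShadowOfSize_iff (K : Set (σ → ℝ)) (m : ℕ) :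
    IsSpectrahedralShadowOfSize K m ↔
      ∃ (p : ℕ) (A : (σ → ℝ) × (Fin p → ℝ) →ₗ[ℝ] Matrix (Fin m) (Fin m) ℝ)
        (B : Matrix (Fin m) (Fin m) ℝ),
        ∀ x : σ → ℝ, x ∈ K ↔ ∃ y : Fin p → ℝ, (A (x, y) + B).PosSemidef :=
  Iff.rfl

/-- A sized representation is a representation. [cite: NetzerSanyal2014, §1 (spectrahedral shadow)] -/
theorem IsSpectrahedralShadowOfSize.isSpectrahedralShadow {K : Set (σ → ℝ)} {m : ℕ}
    (h : IsSpectrahedralShadowOfSize K m) : IsSpectrahedralShadow K :=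
  ⟨m, h⟩

/-- The whole space has a lifted LMI representation of size `0` (the empty matrix is positive
semidefinite) — the degenerate corner `m = 0` noted by the route's refuters.
[cite: SaundersonParrilo2014, §1.2 (convention ℝ^{n,(n)}_+ := ℝⁿ)] -/
theorem isSpectrahedralShadowOfSize_univ_zero :
    IsSpectrahedralShadowOfSize (Set.univ : Set (σ → ℝ)) 0 := by
  refine ⟨0, 0, 0, fun x => ?_⟩
  simp only [Set.mem_univ, true_iff]
  refine ⟨0, ?_⟩
  simpa using Matrix.PosSemidef.zero

/-! ### Named facts -/

section Facts

/-- **Netzer–Sanyal 2015, Theorem 1.1** (arXiv:1208.0441 p. 3, verbatim): "Let `h ∈ ℝ[x]` be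
hyperbolic with respect to `e`. If each non-zero point in the boundary of `Λ_e(h)` is a smooth
point of `h`, then `Λ_e(h)` is a spectrahedral shadow." Dictionary: `h` homogeneous (§1, standing),
hyperbolic in direction `e` = `IsHyperbolic h e` (`h(e) ≠ 0`, only real zeros on lines parallel
to `e`); `Λ_e(h)` = the closed cone `hyperbolicityCone h e` (§1: "`h(a − te)` has only non-negative
real roots"); smooth point of `h` = multiplicity one (§2) = non-vanishing gradient (the boundary
points `a ≠ 0` of the closed cone are zeros of `h`). No size bound is asserted (none is printed).
Grounds the smooth sub-case of `Summit.ValiantsHypothesis.ValiantsHypothesis.Theses.PermanentalCones.HyperbolicVPShadow`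
/ `.HyperbolicDetShadow` (whose constant-family specialisation is the still-open statement for ALL
hyperbolicity cones, p. 6: "we conjecture that all hyperbolicity cones are spectrahedral shadows").
[cite: NetzerSanyal2014, Theorem 1.1] -/
def NetzerSanyal2014_thm11 : Prop :=
  ∀ (n : ℕ) (h : MvPolynomial (Fin n) ℝ) (e : Fin n → ℝ) (d : ℕ), h.IsHomogeneous d →
    IsHyperbolic h e →
    (∀ a ∈ frontier (hyperbolicityCone h e), a ≠ 0 →
        ∃ j : Fin n, MvPolynomial.eval a (MvPolynomial.pderiv j h) ≠ 0) →
    IsSpectrahedralShadow (hyperbolicityCone h e)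

/-- **Saunderson–Parrilo 2015, Theorem 1, orthant form** (arXiv:1208.1443 p. 6, verbatim): "For each
positive integer `n` and each `k = 1, 2, …, n − 1`, the cone `S^{n,(k)}_+` has a semidefinite
representation of size `O(min{k, n−k} n²)`", combined with §1.2 (p. 4): "the `k`th derivative
relaxation of the orthant, which we denote by `ℝ^{n,(k)}_+`, is the hyperbolicity cone
`Λ_+(e_{n−k}, 𝟙_n)`" and "Since `E_i(diag(x)) = e_i(x)` for all `i`, the diagonal slice of
`S^{n,(k)}_+` is exactly `ℝ^{n,(k)}_+`" (a coordinate slice of a size-`m` semidefinite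
representation is a size-`m` semidefinite representation of the slice). The unprinted constant of
the `O(·)` (and the additive constant of the size convention, see the module doc) is the `∃ C`.
Here `e_{n−k}` is Mathlib's `MvPolynomial.esymm (Fin n) ℝ (n − k)` and `𝟙 = fun _ => 1`.
Grounds the single-direction corner (`Y` with all constant rows equal, `Q ∝ e_{n−r}`) of
`Summit.ValiantsHypothesis.ValiantsHypothesis.Theses.PermanentalCones.PermanentalConesEasy`; the
mixed-direction statement of that item is not in print.
[cite: SaundersonParrilo2014, Theorem 1; §1.2] -/
def SaundersonParrilo2014_thm1_orthant : Prop :=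
  ∃ C : ℕ, ∀ (n k : ℕ), 1 ≤ k → k + 1 ≤ n →
    ∃ m : ℕ, m ≤ C * (min k (n - k)) * n ^ 2 ∧
      IsSpectrahedralShadowOfSize
        (hyperbolicityCone (MvPolynomial.esymm (Fin n) ℝ (n - k)) (fun _ => (1 : ℝ))) m

end Facts

end Literature.AlgebraicGeometry.HyperbolicPolynomials

end
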